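import Mathlib

/-!
# Route FilamentSkeletonRss · crux `CoreGluingGivenInvertibilityQR` (stmt-NavierStokesRegularity-19176) —
# line `Sketch`, stub `stub_qrHelicalRadiationInverse`: radiation inverse of the helical (`m = ±1`) end sector

Helper file (theorems only) for the skeleton of the crux `CoreGluingGivenInvertibilityQR`. The neutral
helical (`m = ±1` displacement) end sector of the linearised tube operator along a filament is the
complex first-order equation `i c η′ − w η = f` (`η = ζ′`; `c ≠ 0` the self-induction coefficient,
`w` the continuous tangential sweep, `f` a continuous integrable forcing). Its homogeneous solutions
`exp (−i W / c)` (`W = ∫₀ w`) have constant modulus (`stub_inviscidEndHasNeutralMode`), so the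
outward sweep is not Volterra; the correct inverse is the INWARD sweep with the radiation condition
at `+∞`, `η(τ) = (i/c) e^{−iW(τ)/c} ∫_{(τ,∞)} e^{iW(s)/c} f(s) ds`.
It is differentiable, solves the equation, obeys `‖η τ‖ ≤ |c|⁻¹ ∫_{(τ,∞)} ‖f‖`, and is the unique
differentiable solution tending to `0` at `+∞`: the difference `d` of two solutions times `e^{iW/c}`
has zero derivative, so it is a constant, of modulus `lim ‖d‖ = 0`.

Mathlib only: FTC-1 (`Continuous.integral_hasStrictDerivAt`), the splitting
`intervalIntegral.integral_interval_add_Ioi`, the tail limit `MeasureTheory.tendsto_integral_Ioi_zero`,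
`is_const_of_deriv_eq_zero`, and the chain rule for `Complex.exp`.
-/

set_option linter.dupNamespace false

noncomputable section

namespace Summit.NavierStokesRegularity.NavierStokesRegularity.Theorems

open MeasureTheory Real Set Filter Topology
open scoped InnerProductSpace

/-- FTC for the tail integral of a continuous integrable `g : ℝ → ℂ`: `t ↦ ∫_{(t,∞)} g` has
derivative `−g τ` at every `τ` (split `∫_{(0,∞)} g = ∫₀^t g + ∫_{(t,∞)} g` and differentiate the
interval integral). -/
theorem qrHelical_hasDerivAt_integral_Ioi {g : ℝ → ℂ} (hgc : Continuous g) (hgi : Integrable g)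
    (τ : ℝ) : HasDerivAt (fun t => ∫ s in Set.Ioi t, g s) (-g τ) τ := by
  have h : (fun t => ∫ s in Set.Ioi t, g s) =
      fun t => (∫ s in Set.Ioi 0, g s) - ∫ s in (0 : ℝ)..t, g s :=
    funext fun t => eq_sub_of_add_eq'
      (intervalIntegral.integral_interval_add_Ioi hgi.integrableOn hgi.integrableOn)
  rw [h]
  exact (hgc.integral_hasStrictDerivAt 0 τ).hasDerivAt.const_sub _

/-- Decaying solutions of the homogeneous helical end equation vanish: if `d` is differentiable,
`c i d′ = w d` on `ℝ` (`c ≠ 0`, `W′ = w`) and `d → 0` at `+∞`, then `d ≡ 0` — the product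
`d · exp (i W / c)` has zero derivative, hence is a constant, and its modulus `‖d‖` tends to `0`. -/
theorem qrHelical_homogeneous_eq_zero {c : ℝ} {w W : ℝ → ℝ} {d : ℝ → ℂ} (hc : c ≠ 0)
    (hW : ∀ τ, HasDerivAt W (w τ) τ) (hd : Differentiable ℝ d)
    (hode : ∀ τ, (c : ℂ) * Complex.I * deriv d τ = (w τ : ℂ) * d τ)
    (h0 : Tendsto d atTop (𝓝 0)) : ∀ τ, d τ = 0 := by
  -- the inverse phase `F = exp (i W / c)`: `F' = F · (w/c) i`, `‖F‖ = 1`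
  obtain ⟨F, hF⟩ :
      ∃ F : ℝ → ℂ, F = fun τ => Complex.exp (((W τ / c : ℝ) : ℂ) * Complex.I) := ⟨_, rfl⟩
  have hFd : ∀ τ, HasDerivAt F (F τ * (((w τ / c : ℝ) : ℂ) * Complex.I)) τ := fun τ => by
    rw [hF]
    exact (((hW τ).div_const c).ofReal_comp.mul_const Complex.I).cexp
  have hFn : ∀ τ, ‖F τ‖ = 1 := fun τ => by
    rw [hF]
    exact Complex.norm_exp_ofReal_mul_I _
  have hFne : ∀ τ, F τ ≠ 0 := fun τ => by
    rw [hF]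
    exact Complex.exp_ne_zero _
  have hc' : (c : ℂ) * (c : ℂ)⁻¹ = 1 := mul_inv_cancel₀ (Complex.ofReal_ne_zero.2 hc)
  -- `u := d F` has zero derivative, hence is constant
  have hud : ∀ τ, HasDerivAt (fun t => d t * F t) 0 τ := fun τ => by
    refine ((hd τ).hasDerivAt.fun_mul (hFd τ)).congr_deriv ?_
    have h := hode τ
    push_cast
    linear_combination (-(Complex.I * (c : ℂ)⁻¹ * F τ)) * h
      + (deriv d τ * F τ * (c : ℂ) * (c : ℂ)⁻¹) * Complex.I_mul_I - (deriv d τ * F τ) * hc'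
  have hconst : ∀ x y, d x * F x = d y * F y :=
    is_const_of_deriv_eq_zero (fun τ => (hud τ).differentiableAt) fun τ => (hud τ).deriv
  -- `u → 0` (as `‖u‖ = ‖d‖ → 0`), so the constant is `0`
  have hu0 : Tendsto (fun t => d t * F t) atTop (𝓝 0) :=
    squeeze_zero_norm (a := fun t => ‖d t‖) (fun t => le_of_eq (by rw [norm_mul, hFn, mul_one]))
      (tendsto_zero_iff_norm_tendsto_zero.1 h0)
  have hzero : d 0 * F 0 = 0 :=
    tendsto_nhds_unique tendsto_const_nhds (hu0.congr fun t => hconst t 0)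
  intro τ
  exact (mul_eq_zero.1 ((hconst τ 0).trans hzero)).resolve_right (hFne τ)

/-- The radiation (inward-swept) particular solution from a primitive `W` of `w`: with the phase
`E = exp (−i W / c)` and the twisted forcing `g = exp (i W / c) · f` (continuous, integrable,
`‖g‖ = ‖f‖`), `η τ := E τ · (i/c) ∫_{(τ,∞)} g` is differentiable, solves `c i η′ − w η = f`, and
obeys `‖η τ‖ ≤ |c|⁻¹ ∫_{(τ,∞)} ‖f‖`. -/
theorem qrHelical_particular {c : ℝ} {w W : ℝ → ℝ} {f : ℝ → ℂ} (hc : c ≠ 0)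
    (hW : ∀ τ, HasDerivAt W (w τ) τ) (hf : Continuous f) (hfi : Integrable fun s => ‖f s‖) :
    ∃ η : ℝ → ℂ, Differentiable ℝ η ∧
      (∀ τ, (c : ℂ) * Complex.I * deriv η τ - (w τ : ℂ) * η τ = f τ) ∧
      ∀ τ, ‖η τ‖ ≤ |c|⁻¹ * ∫ s in Set.Ioi τ, ‖f s‖ := by
  -- the phases `E = exp (−i W / c)`, `F = exp (i W / c)`: derivatives, unit modulus, `E F = 1`
  obtain ⟨E, hE⟩ :
      ∃ E : ℝ → ℂ, E = fun τ => Complex.exp (((-(W τ / c) : ℝ) : ℂ) * Complex.I) := ⟨_, rfl⟩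
  obtain ⟨F, hF⟩ :
      ∃ F : ℝ → ℂ, F = fun τ => Complex.exp (((W τ / c : ℝ) : ℂ) * Complex.I) := ⟨_, rfl⟩
  have hEd : ∀ τ, HasDerivAt E (E τ * (((-(w τ / c) : ℝ) : ℂ) * Complex.I)) τ := fun τ => by
    rw [hE]
    exact (((hW τ).div_const c).neg.ofReal_comp.mul_const Complex.I).cexp
  have hFd : ∀ τ, HasDerivAt F (F τ * (((w τ / c : ℝ) : ℂ) * Complex.I)) τ := fun τ => by
    rw [hF]
    exact (((hW τ).div_const c).ofReal_comp.mul_const Complex.I).cexp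
  have hEn : ∀ τ, ‖E τ‖ = 1 := fun τ => by
    rw [hE]
    exact Complex.norm_exp_ofReal_mul_I _
  have hFn : ∀ τ, ‖F τ‖ = 1 := fun τ => by
    rw [hF]
    exact Complex.norm_exp_ofReal_mul_I _
  have hEF : ∀ τ, E τ * F τ = 1 := fun τ => by
    have h0 : (((-(W τ / c) : ℝ) : ℂ) * Complex.I) + (((W τ / c : ℝ) : ℂ) * Complex.I) = 0 := by
      push_cast
      ring
    rw [hE, hF]
    exact (Complex.exp_add _ _).symm.trans (by rw [h0, Complex.exp_zero])
  have hc' : (c : ℂ) * (c : ℂ)⁻¹ = 1 := mul_inv_cancel₀ (Complex.ofReal_ne_zero.2 hc)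
  -- the twisted forcing `g = F f`: continuous, integrable, `‖g‖ = ‖f‖`
  have hFc : Continuous F := continuous_iff_continuousAt.2 fun τ => (hFd τ).continuousAt
  obtain ⟨g, hg⟩ : ∃ g : ℝ → ℂ, g = fun s => F s * f s := ⟨_, rfl⟩
  have hgv : ∀ s, g s = F s * f s := fun s => by rw [hg]
  have hgc : Continuous g := by
    rw [hg]
    exact hFc.mul hf
  have hgn : ∀ s, ‖g s‖ = ‖f s‖ := fun s => by
    rw [hgv, norm_mul, hFn, one_mul]
  have hgi : Integrable g :=
    hfi.mono' hgc.aestronglyMeasurable (Eventually.of_forall fun s => (hgn s).le)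
  -- the tail `K τ = ∫_{(τ,∞)} g`: derivative `−g τ`, bound `‖K τ‖ ≤ ∫_{(τ,∞)} ‖f‖`
  obtain ⟨K, hK⟩ : ∃ K : ℝ → ℂ, K = fun τ => ∫ s in Set.Ioi τ, g s := ⟨_, rfl⟩
  have hKd : ∀ τ, HasDerivAt K (-g τ) τ := fun τ => by
    rw [hK]
    exact qrHelical_hasDerivAt_integral_Ioi hgc hgi τ
  have hKn : ∀ τ, ‖K τ‖ ≤ ∫ s in Set.Ioi τ, ‖f s‖ := fun τ => by
    rw [hK]
    exact norm_integral_le_of_norm_le hfi.integrableOn (Eventually.of_forall fun s => (hgn s).le)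
  -- the candidate `η = E · (i/c) K` and its derivative (product rule)
  obtain ⟨η, hη⟩ : ∃ η : ℝ → ℂ, η = fun τ => E τ * ((Complex.I / (c : ℂ)) * K τ) := ⟨_, rfl⟩
  have hηv : ∀ τ, η τ = E τ * ((Complex.I / (c : ℂ)) * K τ) := fun τ => by rw [hη]
  have hηd : ∀ τ, HasDerivAt η (E τ * (((-(w τ / c) : ℝ) : ℂ) * Complex.I) *
      ((Complex.I / (c : ℂ)) * K τ) + E τ * ((Complex.I / (c : ℂ)) * -g τ)) τ := fun τ => by
    rw [hη]
    exact (hEd τ).fun_mul ((hKd τ).const_mul _)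
  refine ⟨η, fun τ => (hηd τ).differentiableAt, fun τ => ?_, fun τ => ?_⟩
  · -- the equation: `c i η′ − w η = (−i·i)(c/c) w η − w η + (−i·i)(c/c) E F f = f`
    rw [(hηd τ).deriv, hηv, hgv]
    push_cast
    linear_combination
      (-((c : ℂ) * (c : ℂ)⁻¹ ^ 2 * (w τ : ℂ) * E τ * K τ * Complex.I)
          - (c : ℂ) * (c : ℂ)⁻¹ * E τ * F τ * f τ) * Complex.I_mul_I
        + ((c : ℂ)⁻¹ * (w τ : ℂ) * E τ * K τ * Complex.I + E τ * F τ * f τ) * hc'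
        + (f τ) * hEF τ
  · -- the bound: `‖η τ‖ = |c|⁻¹ ‖K τ‖ ≤ |c|⁻¹ ∫_{(τ,∞)} ‖f‖`
    rw [hηv, norm_mul, norm_mul, hEn, one_mul, norm_div, Complex.norm_I, Complex.norm_real,
      Real.norm_eq_abs, one_div]
    exact mul_le_mul_of_nonneg_left (hKn τ) (inv_nonneg.2 (abs_nonneg c))

/-- **stub_qrHelicalRadiationInverse (cards group-velocity-dichotomy / volterra-ends).** For every
self-induction coefficient `c ≠ 0`, continuous sweep `w` and continuous forcing `f` with `‖f‖`
integrable, the helical end equation `i c η′ − w η = f` has the radiation (inward-swept) solution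
`η(τ) = (i/c) e^{−iW(τ)/c} ∫_{(τ,∞)} e^{iW/c} f` (`W = ∫₀ w`): it is differentiable, solves the
equation on `ℝ`, obeys the tail bound `‖η τ‖ ≤ |c|⁻¹ ∫_{(τ,∞)} ‖f‖`, and it is the unique
differentiable solution tending to `0` at `+∞`. -/
theorem stub_qrHelicalRadiationInverse :
    ∀ (c : ℝ) (w : ℝ → ℝ) (f : ℝ → ℂ), c ≠ 0 → Continuous w → Continuous f →
      Integrable (fun s => ‖f s‖) →
      ∃ η : ℝ → ℂ, Differentiable ℝ η ∧
        (∀ τ, (c : ℂ) * Complex.I * deriv η τ - (w τ : ℂ) * η τ = f τ) ∧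
        (∀ τ, ‖η τ‖ ≤ |c|⁻¹ * ∫ s in Set.Ioi τ, ‖f s‖) ∧
        ∀ η₂ : ℝ → ℂ, Differentiable ℝ η₂ →
          (∀ τ, (c : ℂ) * Complex.I * deriv η₂ τ - (w τ : ℂ) * η₂ τ = f τ) →
          Tendsto η₂ atTop (𝓝 0) → η₂ = η := by
  intro c w f hc hw hf hfi
  -- the primitive `W = ∫₀ w` of the continuous sweep (FTC-1)
  have hW : ∀ τ, HasDerivAt (fun t => ∫ s in (0 : ℝ)..t, w s) (w τ) τ :=
    fun τ => (hw.integral_hasStrictDerivAt 0 τ).hasDerivAt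
  obtain ⟨η, hηd, hηode, hηb⟩ := qrHelical_particular hc hW hf hfi
  refine ⟨η, hηd, hηode, hηb, fun η₂ hη₂ hode₂ hT => ?_⟩
  -- `η → 0` at `+∞`: its bound is `|c|⁻¹` times a tail integral of the integrable `‖f‖`
  have hη0 : Tendsto η atTop (𝓝 0) := by
    refine squeeze_zero_norm hηb ?_
    have h := (tendsto_integral_Ioi_zero (f := fun s => ‖f s‖) (μ := volume) (l := atTop)
      tendsto_id).const_mul |c|⁻¹
    rw [mul_zero] at h
    exact h
  -- `d := η₂ − η` solves the homogeneous equation and decays, hence vanishes identically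
  have hd : ∀ τ, η₂ τ - η τ = 0 := by
    refine qrHelical_homogeneous_eq_zero (d := fun τ => η₂ τ - η τ) hc hW
      (fun τ => (hη₂ τ).sub (hηd τ)) (fun τ => ?_) ?_
    · show (c : ℂ) * Complex.I * deriv (fun t => η₂ t - η t) τ = (w τ : ℂ) * (η₂ τ - η τ)
      rw [((hη₂ τ).hasDerivAt.fun_sub (hηd τ).hasDerivAt).deriv]
      linear_combination hode₂ τ - hηode τ
    · have h := hT.sub hη0
      rw [sub_zero] at h
      exact h
  exact funext fun τ => sub_eq_zero.1 (hd τ)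

end Summit.NavierStokesRegularity.NavierStokesRegularity.Theorems
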